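import Literature.Probability.Distributions.GaussianHypercontractivity
import HarnessLib

/-!
# Crux `BoxMidWindowsSU22` (stmt-QuantumFields-24003, route `AllWindowsColdBox`), LINE-17 «hypercontractive second-order
# tilt expansion» (planner ym-idea-2 g14, skeleton v3 sha16 `4747b363e792659d`, critic idea-crit-4 g8 PASS 2026-08-29T05:35Z):
# registered stub B `stub_gaussPolyHypercontractivity : GaussPolyHypercontractivity` — LANDED BY NAME

Obligation B of the line is GAUSSIAN HYPERCONTRACTIVITY IN EVEN-MOMENT FORM: for a real polynomial `P` of total degree `≤ m`
in `n` independent standard Gaussians and every `k ≥ 1`,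

  `∫ P^{2k} dγₙ ≤ (2k − 1)^{k m} · (∫ P² dγₙ)^k`,  `γₙ = Measure.pi fun _ : Fin n => gaussianReal 0 1`

(Bonami 1970 on the cube; Nelson 1973 / Gross 1975 §4 for Gauss space; Janson, *Gaussian Hilbert Spaces* (1997) Thm 5.10).
The line's STUB-MAP (HOME ideators/ym-idea-2/l19/STUB-MAP-24003-v3.md §B) proposed to prove it from the tree's Boolean
Bonami lemma by the Rademacher embedding and the moment central limit theorem.  THAT PROOF IS ALREADY IN THE TREE:
`Literature.Probability.Distributions.gaussian_bonami_pi` (file `Literature/Probability/Distributions/GaussianHypercontractivity.lean`,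
exactly Gross's route: `isLevelLE_embedEval` + `bonami_even_moment` + `RademacherEvenMoments.tendsto_radMomentN`).  This file is
therefore pure bookkeeping: the registered Prop is restated verbatim (so that the stub lands by name and signature) and discharged by
the Literature theorem; the only difference between the two statements is the spelling of the constant, `((2k − 1 : ℕ) : ℝ)` in the
stub versus `(2k − 1 : ℝ)` in the Literature theorem, equal since `1 ≤ k`.

Also serves LINE-18 on the sibling crux `BulkMidWindowSU2` (stmt-QuantumFields-24006), whose stub S2 `stub_flatTiltInputs` is the
bundle A ∧ B ∧ C ∧ D of LINE-17's first four obligations.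

HONEST LABEL: a registered glue obligation of two critic-passed lines on the R2ξ″ RECORD-rung cruxes 24003/24006 is discharged onto an
existing Literature theorem; no crux, rung or summit is proved here; the Clay Yang–Mills mass gap is NOT proved by any of this.
-/

set_option autoImplicit false

noncomputable section

open MeasureTheory ProbabilityTheory

namespace Summit.QuantumFields.YangMills.Theorems.AllWindowsColdBox.GaussHypercontractivity

/-- **Obligation B of LINE-17, restated verbatim** from the registered skeleton v3 (sha16 `4747b363e792659d`,
`Summit.QuantumFields.YangMills.Cruxes.BoxMidWindowsSU22.BirthV3.GaussPolyHypercontractivity`): Gaussian hypercontractivity in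
even-moment form for polynomials — for `P : MvPolynomial (Fin n) ℝ` of total degree `≤ m` and `k ≥ 1`,
`E[P^{2k}] ≤ (2k−1)^{km} · (E[P²])^k` under the standard Gaussian product measure. -/
def GaussPolyHypercontractivity : Prop :=
  ∀ (n m k : ℕ) (P : MvPolynomial (Fin n) ℝ), P.totalDegree ≤ m → 1 ≤ k →
    ∫ x, (MvPolynomial.eval x P) ^ (2 * k) ∂(Measure.pi fun _ : Fin n => gaussianReal 0 1) ≤
      ((2 * k - 1 : ℕ) : ℝ) ^ (k * m) * (∫ x, (MvPolynomial.eval x P) ^ 2 ∂(Measure.pi fun _ : Fin n => gaussianReal 0 1)) ^ k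

/-- **Registered stub B of LINE-17 (crux 24003), by name**: Gaussian hypercontractivity for polynomials in even-moment form,
`∫ P^{2k} dγₙ ≤ (2k−1)^{km} (∫ P² dγₙ)^k` for `totalDegree P ≤ m`, `1 ≤ k` — an instance of the tree's
`Literature.Probability.Distributions.gaussian_bonami_pi` (Bonami–Nelson–Gross; Janson 1997 Thm 5.10), after rewriting the
natural-number cast of the constant `2k − 1`. -/
theorem stub_gaussPolyHypercontractivity : GaussPolyHypercontractivity := by
  intro n m k P hP hk
  have hcast : ((2 * k - 1 : ℕ) : ℝ) = (2 * k - 1 : ℝ) := by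
    have h1 : 1 ≤ 2 * k := by omega
    rw [Nat.cast_sub h1]
    push_cast
    ring
  rw [hcast]
  exact Literature.Probability.Distributions.gaussian_bonami_pi m P hP k hk

end Summit.QuantumFields.YangMills.Theorems.AllWindowsColdBox.GaussHypercontractivity

end
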